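import Summits.AtomisticToContinuum.HydrodynamicLimit.Theorems.JParityClosureLocalSecondLawContactCondLaw

/-!
# Stub B′ (`stub_initialMatching`) of the line `contact-asymmetry-information` for the crux `LocalSecondLaw`
(stmt-AtomisticToContinuum-13081) — part 6: the velocity tilt budget of bounded tilts (conditioning lemma, velocity part)

The ENTROPY input of the initial matching on the velocity side, for bounded test functions.  For the local Gibbs law
`P_N` (continuous profiles, `σ ≤ 1/2`), a cell `S` of positive mass, the bounded tilt `ν = P_N(·|S)` (`condLaw`) and a
one-particle density `f` of `ν` (`IsOneParticleDensity`):
* `contactB_condLaw_integral_le_log` — the Gibbs variational (Donsker–Varadhan) inequality for conditioning, by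
  Jensen: `E_ν F ≤ log(1/P_N(S)) + log E_{P_N} e^F` for bounded measurable `F`;
* `contactB_lintegral_prod_velTilt_le_one` — the conditional product structure of the velocities
  (`lintegral_localGibbsMeasure`: given the positions the velocities are independent `N(u₀(xᵢ), θ₀(xᵢ)𝟙)`):
  `E_{P_N} ∏ᵢ g(zᵢ) ≤ 1` whenever every Gaussian velocity average of `g ≥ 0` is `≤ 1`;
* `contactB_velocityTiltBudget_bdd` — hence for every bounded measurable velocity tilt `ψ` with
  `∫ e^{ψ(y,·)} dN(u₀(y),θ₀(y)𝟙) ≤ 1` (all `y`): `∫∫ ψ f(0,·) ≤ log(1/P_N(S))/(N+1)` (time-zero duality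
  `contactB_onePt_zero`).  Optimising over `ψ` (truncations of `log (f(0,y,·)/(ρ_f(y)M_y))`) gives the velocity
  relative-entropy budget `∫ ρ_f KL(f̂(0,y,·) ‖ M_{1,u₀(y),θ₀(y)}) dy ≤ log(1/P_N(S))/(N+1) → 0` of the conditioning
  lemma: conditioning on an event of mass `≥ δ″` cannot move the one-particle VELOCITY law away from the local
  Maxwellians by more than `O(log(1/δ″)/N)` nats.

References: I. Csiszár, *I-divergence geometry of probability distributions and minimization problems*, Ann. Probab.
3 (1975) 146–158 (conditioning and relative entropy); M. D. Donsker, S. R. S. Varadhan, Comm. Pure Appl. Math. 28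
(1975) 1–47 (variational formula); H. Spohn, *Large Scale Dynamics of Interacting Particles* (1991), Part I §2.3.
-/

noncomputable section

open scoped BigOperators Topology Classical MeasureTheory ENNReal InnerProductSpace
open Filter Set MeasureTheory Function
open Literature.MathematicalPhysics.KineticTheory
open Literature.Analysis.FluidPDE
open Summit.AtomisticToContinuum.HydrodynamicLimit.Theorems.LocalSecondLawNegative
open Summit.AtomisticToContinuum.HydrodynamicLimit.Theorems.LocalSecondLawLedger

namespace Summit.AtomisticToContinuum.HydrodynamicLimit.Theorems.LocalSecondLawContact

/-- **Gibbs variational inequality for conditioning** (Jensen): for a bounded measurable `F` and a cell of positive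
mass, `E_{μ(·|S)}[F] ≤ log(1/μ(S)) + log E_μ[e^F]` — the relative entropy `H(μ(·|S) | μ) = log(1/μ(S))` paid in the
Donsker–Varadhan form, here simply `E_ν F ≤ log E_ν e^F ≤ log((μ S)⁻¹ E_μ e^F)`. -/
theorem contactB_condLaw_integral_le_log :
    ∀ {N : ℕ} (μ : Measure (Phase N)) [IsProbabilityMeasure μ] (S : Set (Phase N)) (F : Phase N → ℝ) (b : ℝ),
      Measurable F → (∀ z, |F z| ≤ b) → μ S ≠ 0 →
      ∫ z, F z ∂(condLaw μ S) ≤ Real.log ((μ S).toReal⁻¹) + Real.log (∫ z, Real.exp (F z) ∂μ) := by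
  intro N μ _ S F b hFm hFb h0
  have htop : μ S ≠ ⊤ := measure_ne_top μ S
  set ν : Measure (Phase N) := condLaw μ S
  haveI : IsProbabilityMeasure ν := contactB_condLaw_isProbability μ S h0 htop
  set G : Phase N → ℝ := fun z => Real.exp (F z)
  have hGm : Measurable G := Real.measurable_exp.comp hFm
  have hGlo : ∀ z, Real.exp (-b) ≤ G z := fun z => Real.exp_le_exp.2 (neg_le_of_abs_le (hFb z))
  have hGhi : ∀ z, G z ≤ Real.exp b := fun z => Real.exp_le_exp.2 (le_of_abs_le (hFb z))
  have hGi : ∀ (ρ : Measure (Phase N)) [IsProbabilityMeasure ρ], Integrable G ρ := fun ρ _ =>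
    Integrable.of_bound hGm.aestronglyMeasurable (Real.exp b) (Eventually.of_forall fun z => by
      rw [Real.norm_eq_abs, abs_of_pos (Real.exp_pos _)]; exact hGhi z)
  have hFi : ∀ (ρ : Measure (Phase N)) [IsProbabilityMeasure ρ], Integrable F ρ := fun ρ _ =>
    Integrable.of_bound hFm.aestronglyMeasurable b (Eventually.of_forall fun z => by
      rw [Real.norm_eq_abs]; exact hFb z)
  -- Jensen for the concave `log` on `[e^{-b}, e^{b}]`
  have hpos : (0 : ℝ) < Real.exp (-b) := Real.exp_pos _
  have hsub : Set.Icc (Real.exp (-b)) (Real.exp b) ⊆ Set.Ioi 0 := fun t ht => lt_of_lt_of_le hpos ht.1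
  have hconc : ConcaveOn ℝ (Set.Icc (Real.exp (-b)) (Real.exp b)) Real.log :=
    strictConcaveOn_log_Ioi.concaveOn.subset hsub (convex_Icc _ _)
  have hcont : ContinuousOn Real.log (Set.Icc (Real.exp (-b)) (Real.exp b)) :=
    Real.continuousOn_log.mono fun t ht => (lt_of_lt_of_le hpos ht.1).ne'
  have hJ : ∫ z, Real.log (G z) ∂ν ≤ Real.log (∫ z, G z ∂ν) :=
    hconc.le_map_integral hcont isClosed_Icc (Eventually.of_forall fun z => ⟨hGlo z, hGhi z⟩) (hGi ν)
      (by simpa only [Function.comp_def, G, Real.log_exp] using hFi ν)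
  have hlogG : (fun z => Real.log (G z)) = F := funext fun z => Real.log_exp (F z)
  rw [hlogG] at hJ
  -- domination of the conditioned expectation of `e^F`
  have hνμ : ∫ z, G z ∂ν ≤ ((μ S)⁻¹).toReal * ∫ z, G z ∂μ :=
    contactB_condLaw_integral_le μ S G (fun z => (Real.exp_pos _).le) (hGi μ)
  have hνpos : 0 < ∫ z, G z ∂ν := by
    have h1 : ∫ _z, Real.exp (-b) ∂ν ≤ ∫ z, G z ∂ν := integral_mono (integrable_const _) (hGi ν) hGlo
    rw [integral_const, probReal_univ, one_smul] at h1
    exact lt_of_lt_of_le hpos h1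
  have hμpos : 0 < ∫ z, G z ∂μ := by
    have h1 : ∫ _z, Real.exp (-b) ∂μ ≤ ∫ z, G z ∂μ := integral_mono (integrable_const _) (hGi μ) hGlo
    rw [integral_const, probReal_univ, one_smul] at h1
    exact lt_of_lt_of_le hpos h1
  have hinvpos : 0 < ((μ S)⁻¹).toReal :=
    ENNReal.toReal_pos (ENNReal.inv_ne_zero.2 htop) (ENNReal.inv_ne_top.2 h0)
  calc ∫ z, F z ∂ν ≤ Real.log (∫ z, G z ∂ν) := hJ
    _ ≤ Real.log (((μ S)⁻¹).toReal * ∫ z, G z ∂μ) := Real.log_le_log hνpos hνμ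
    _ = Real.log ((μ S).toReal⁻¹) + Real.log (∫ z, G z ∂μ) := by
        rw [Real.log_mul hinvpos.ne' hμpos.ne', ENNReal.toReal_inv]

/-- **Conditional product structure of the velocities**: for a measurable `g ≥ 0` on the one-particle phase space whose
Gaussian velocity averages `∫ g(y,·) dN(u₀(y), θ₀(y)𝟙)` are `≤ 1` at every position, `E_{P_N}[∏ᵢ g(zᵢ)] ≤ 1`
(disintegration `lintegral_localGibbsMeasure` + Tonelli for the product velocity law). -/
theorem contactB_lintegral_prod_velTilt_le_one :
    ∀ {N : ℕ} (σ : ℝ) (a₀ θ₀ : T3 → ℝ) (u₀ : T3 → V3), Continuous a₀ → Continuous θ₀ → Continuous u₀ →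
      (∀ x, 0 < a₀ x) → (∀ x, 0 < θ₀ x) → σ ≤ 1 / 2 →
      ∀ (Φ : Flow σ N) (g : T3 × V3 → ℝ≥0∞), Measurable g →
        (∀ y : T3, ∫⁻ v, g (y, v) ∂(gaussMeasure (u₀ y) (θ₀ y)) ≤ 1) →
        ∫⁻ z, ∏ i, g (z i) ∂(localGibbsLaw σ a₀ u₀ θ₀ N Φ) ≤ 1 := by
  intro N σ a₀ θ₀ u₀ ha hθ hu ha0 hθ0 hσ2 Φ g hg hg1
  haveI : IsProbabilityMeasure (localGibbsMeasure σ a₀ u₀ θ₀ N) :=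
    isProbabilityMeasure_localGibbsMeasure ha hθ hu ha0 hθ0 hσ2 N
  have hG : Measurable fun z : Phase N => ∏ i, g (z i) :=
    Finset.measurable_prod _ fun i _ => hg.comp (measurable_pi_apply i)
  rw [localGibbsLaw_eq, lintegral_localGibbsMeasure ha hθ hu (fun x => (ha0 x).le) hθ0 σ N hG]
  have hinner : ∀ x : Fin (N + 1) → T3, ∫⁻ v, ∏ i, g ((zipConfig (x, v)) i) ∂(velMeasure u₀ θ₀ x) ≤ 1 := by
    intro x
    unfold velMeasure
    simp only [zipConfig_apply]
    rw [lintegral_fintype_prod_eq_prod' (fun i => gaussMeasure (u₀ (x i)) (θ₀ (x i)))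
      (f := fun i w => g (x i, w)) (fun i => hg.comp (measurable_const.prodMk measurable_id))]
    exact Finset.prod_le_one (fun _ _ => bot_le) fun i _ => hg1 (x i)
  calc ∫⁻ x, ENNReal.ofReal ((canonicalPartition (Torus.geometry (Fin 3)) (hsDiameter σ N) (N + 1)
          (localGibbsProfile a₀ u₀ θ₀))⁻¹ * posWeight a₀ (hsDiameter σ N) (N + 1) x) *
          ∫⁻ v, ∏ i, g ((zipConfig (x, v)) i) ∂(velMeasure u₀ θ₀ x)
      ≤ ∫⁻ x, ENNReal.ofReal ((canonicalPartition (Torus.geometry (Fin 3)) (hsDiameter σ N) (N + 1)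
          (localGibbsProfile a₀ u₀ θ₀))⁻¹ * posWeight a₀ (hsDiameter σ N) (N + 1) x) * 1 :=
        lintegral_mono fun x => mul_le_mul_right (hinner x) _
    _ = 1 := by
        rw [lintegral_mul_const' _ _ ENNReal.one_ne_top,
          lintegral_posWeight_eq_one ha hθ hu (fun x => (ha0 x).le) hθ0 σ N, one_mul]

/-- **Velocity tilt budget of bounded tilts (input (a) of B′, bounded test functions).**  For every bounded measurable
velocity tilt `ψ` that is sub-normalised against the local Maxwellians, `∫ e^{ψ(y,v)} N(u₀(y),θ₀(y)𝟙)(dv) ≤ 1` for all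
`y` (i.e. `∫ M_{1,u₀(y),θ₀(y)}(v) e^{ψ(y,v)} dv ≤ 1`, `withDensity_localMaxwellian_eq_gaussMeasure`), the time-zero
one-particle density `f` of ANY bounded tilt `P_N(·|S)` pays at most `log(1/P_N(S))/(N+1)`:
`∫∫ ψ f(0,·) ≤ log(1/P_N(S))/(N+1)`.  Proof: Jensen under `P_N(·|S)` (`contactB_condLaw_integral_le_log`) for
`F = ∑ᵢ ψ(zᵢ)`, `E_{P_N} e^F = E_{P_N} ∏ᵢ e^{ψ(zᵢ)} ≤ 1` by the conditional product structure of the velocities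
(`contactB_lintegral_prod_velTilt_le_one`), and the time-zero duality `E_ν[(N+1)⁻¹∑ψ(zᵢ)] = ∫ ψ f(0,·)`
(`contactB_onePt_zero`).  With `ψ = log (f(0,y,·)/(ρ_f(y) M_y))` (after truncation) this is the velocity
relative-entropy budget `∫ ρ_f(y) KL(f̂(0,y,·) ‖ M_y) dy ≤ log(1/P_N(S))/(N+1)` of the conditioning lemma. -/
theorem contactB_velocityTiltBudget_bdd :
    ∀ {N : ℕ} {σ τ : ℝ} (a₀ θ₀ : T3 → ℝ) (u₀ : T3 → V3), Continuous a₀ → Continuous θ₀ → Continuous u₀ →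
      (∀ x, 0 < a₀ x) → (∀ x, 0 < θ₀ x) → σ ≤ 1 / 2 → 0 ≤ τ →
      ∀ (Φ : Flow σ N) (S : Set (Phase N)) (f : Pt1 → ℝ), localGibbsLaw σ a₀ u₀ θ₀ N Φ S ≠ 0 →
        IsOneParticleDensity τ (condLaw (localGibbsLaw σ a₀ u₀ θ₀ N Φ) S) Φ f →
        ∀ ψ : T3 × V3 → ℝ, Measurable ψ → (∃ b : ℝ, ∀ p, |ψ p| ≤ b) →
          (∀ y : T3, ∫ v, Real.exp (ψ (y, v)) ∂(gaussMeasure (u₀ y) (θ₀ y)) ≤ 1) →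
          ∫ p : T3 × V3, ψ p * f (0, p) ≤
            Real.log ((localGibbsLaw σ a₀ u₀ θ₀ N Φ S).toReal⁻¹) / (N + 1) := by
  intro N σ τ a₀ θ₀ u₀ ha hθ hu ha0 hθ0 hσ2 hτ Φ S f hS0 hf ψ hψm hψb hψ1
  obtain ⟨b, hb⟩ := hψb
  have hb0 : 0 ≤ b := (abs_nonneg _).trans (hb (Classical.arbitrary _))
  set μ : Measure (Phase N) := localGibbsLaw σ a₀ u₀ θ₀ N Φ
  haveI : IsProbabilityMeasure μ := isProbabilityMeasure_localGibbsLaw ha hθ hu ha0 hθ0 hσ2 N Φ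
  set ν : Measure (Phase N) := condLaw μ S
  have hN : (0 : ℝ) < (N + 1 : ℝ) := by positivity
  -- the N-particle observable
  set F : Phase N → ℝ := fun z => ∑ i : Fin (N + 1), ψ (z i)
  have hFm : Measurable F := Finset.measurable_sum _ fun i _ => hψm.comp (measurable_pi_apply i)
  have hFb : ∀ z, |F z| ≤ (N + 1 : ℝ) * b := fun z => by
    calc |F z| ≤ ∑ i : Fin (N + 1), |ψ (z i)| := Finset.abs_sum_le_sum_abs _ _
      _ ≤ ∑ _i : Fin (N + 1), b := Finset.sum_le_sum fun i _ => hb _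
      _ = (N + 1 : ℝ) * b := by
          rw [Finset.sum_const, Finset.card_univ, Fintype.card_fin, nsmul_eq_mul]; push_cast; ring
  -- Jensen for conditioning
  have hJ := contactB_condLaw_integral_le_log μ S F ((N + 1 : ℝ) * b) hFm hFb hS0
  -- the exponential moment is at most one
  have hexp : ∫ z, Real.exp (F z) ∂μ ≤ 1 := by
    set g : T3 × V3 → ℝ≥0∞ := fun p => ENNReal.ofReal (Real.exp (ψ p))
    have hgm : Measurable g := (Real.measurable_exp.comp hψm).ennreal_ofReal
    have hg1 : ∀ y : T3, ∫⁻ v, g (y, v) ∂(gaussMeasure (u₀ y) (θ₀ y)) ≤ 1 := by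
      intro y
      have hi : Integrable (fun v => Real.exp (ψ (y, v))) (gaussMeasure (u₀ y) (θ₀ y)) :=
        Integrable.of_bound ((Real.measurable_exp.comp (hψm.comp (measurable_const.prodMk measurable_id)))
          |>.aestronglyMeasurable) (Real.exp b) (Eventually.of_forall fun v => by
            rw [Real.norm_eq_abs, abs_of_pos (Real.exp_pos _)]
            exact Real.exp_le_exp.2 (le_of_abs_le (hb _)))
      have h := ofReal_integral_eq_lintegral_ofReal hi (Eventually.of_forall fun v => (Real.exp_pos _).le)
      show ∫⁻ v, ENNReal.ofReal (Real.exp (ψ (y, v))) ∂(gaussMeasure (u₀ y) (θ₀ y)) ≤ 1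
      rw [← h, ← ENNReal.ofReal_one]
      exact ENNReal.ofReal_le_ofReal (hψ1 y)
    have hprod := contactB_lintegral_prod_velTilt_le_one σ a₀ θ₀ u₀ ha hθ hu ha0 hθ0 hσ2 Φ g hgm hg1
    have hFi : Integrable (fun z => Real.exp (F z)) μ :=
      Integrable.of_bound (Real.measurable_exp.comp hFm).aestronglyMeasurable (Real.exp ((N + 1 : ℝ) * b))
        (Eventually.of_forall fun z => by
          rw [Real.norm_eq_abs, abs_of_pos (Real.exp_pos _)]
          exact Real.exp_le_exp.2 (le_of_abs_le (hFb z)))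
    have hrepr : ∀ z : Phase N, ENNReal.ofReal (Real.exp (F z)) = ∏ i, g (z i) := fun z => by
      show ENNReal.ofReal (Real.exp (∑ i : Fin (N + 1), ψ (z i))) = ∏ i, ENNReal.ofReal (Real.exp (ψ (z i)))
      rw [Real.exp_sum, ENNReal.ofReal_prod_of_nonneg fun i _ => (Real.exp_pos _).le]
    have h := ofReal_integral_eq_lintegral_ofReal hFi (Eventually.of_forall fun z => (Real.exp_pos _).le)
    simp_rw [hrepr] at h
    have h2 : ENNReal.ofReal (∫ z, Real.exp (F z) ∂μ) ≤ ENNReal.ofReal 1 := by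
      rw [h, ENNReal.ofReal_one]; exact hprod
    exact (ENNReal.ofReal_le_ofReal_iff zero_le_one).1 h2
  have hμexp_pos : 0 < ∫ z, Real.exp (F z) ∂μ := by
    have hFi : Integrable (fun z => Real.exp (F z)) μ :=
      Integrable.of_bound (Real.measurable_exp.comp hFm).aestronglyMeasurable (Real.exp ((N + 1 : ℝ) * b))
        (Eventually.of_forall fun z => by
          rw [Real.norm_eq_abs, abs_of_pos (Real.exp_pos _)]
          exact Real.exp_le_exp.2 (le_of_abs_le (hFb z)))
    have h1 : ∫ _z, Real.exp (-((N + 1 : ℝ) * b)) ∂μ ≤ ∫ z, Real.exp (F z) ∂μ :=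
      integral_mono (integrable_const _) hFi fun z => Real.exp_le_exp.2 (neg_le_of_abs_le (hFb z))
    rw [integral_const, probReal_univ, one_smul] at h1
    exact lt_of_lt_of_le (Real.exp_pos _) h1
  have hlog0 : Real.log (∫ z, Real.exp (F z) ∂μ) ≤ 0 := Real.log_nonpos hμexp_pos.le hexp
  -- the conditioned expectation of `F` through the one-particle density
  have hflow := contactB_flow_zero_ae_condLaw σ a₀ θ₀ u₀ Φ S
  obtain ⟨-, hdual⟩ := contactB_onePt_zero ν Φ f hτ hf hflow ψ hψm ⟨b, hb⟩
  have hFν : ∫ z, F z ∂ν = (N + 1 : ℝ) * ∫ p : T3 × V3, ψ p * f (0, p) := by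
    rw [← hdual, ← integral_const_mul]
    refine integral_congr_ae (Eventually.of_forall fun z => ?_)
    show ∑ i : Fin (N + 1), ψ (z i) = (N + 1 : ℝ) * ((N + 1 : ℝ)⁻¹ * ∑ i : Fin (N + 1), ψ (z i))
    rw [← mul_assoc, mul_inv_cancel₀ hN.ne', one_mul]
  rw [le_div_iff₀ hN, mul_comm]
  calc (N + 1 : ℝ) * ∫ p : T3 × V3, ψ p * f (0, p) = ∫ z, F z ∂ν := hFν.symm
    _ ≤ Real.log ((μ S).toReal⁻¹) + Real.log (∫ z, Real.exp (F z) ∂μ) := hJ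
    _ ≤ Real.log ((μ S).toReal⁻¹) := by linarith

end Summit.AtomisticToContinuum.HydrodynamicLimit.Theorems.LocalSecondLawContact

end
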